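import Summits.RiemannHypothesis.RiemannHypothesis.Theorems.PfPersistenceGalerkinFormEngine
import Summits.RiemannHypothesis.RiemannHypothesis.Theorems.PfPersistenceGalerkinFormMellin
import HarnessLib

/-!
# PF persistence — GAL-0 piece (ii), STEP 4: the approximating TEST FUNCTIONS `F ⋆ φ_k` of a
# rough compactly supported `F`, and their autocorrelations (pub-rhpf barrier-prover g2)

HONEST FRAMING: long-odds mechanism search; no RH claims.  Continues
`…GalerkinFormMellin` (3a), `…GalerkinFormDecay` (3b), `…GalerkinFormAutocorr` (2) and
`…GalerkinFormEngine` (3c: the Weil functional along the squared mollifiers `ν_k = φ_k ⋆ φ_k`).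

For `F : ℝ → ℂ` measurable, bounded, integrable, with compact support (e.g. a cut-off Galerkin
profile `1_{[-b,b]} θ_v`, which is NOT continuous) and the tree's mollifiers
`φ_k = WeilContinuous.moll k`, PROVED here (RH-free):

* `isWeilTest_weilConv_moll_of_locallyIntegrable` — `F ⋆ φ_k` is a Weil test function
  (smoothness needs only local integrability of `F`);
* `weilConv_moll_eq_zero_of_radius`, `tsupport_weilConv_moll_subset` — if `F = 0` off `[-R, R]`
  then `supp (F ⋆ φ_k) ⊆ [-(R + r_k), R + r_k]`, `r_k = 1/(k+1)`;
* `weilConv_moll_neg` — `F` even ⇒ `F ⋆ φ_k` even (`φ_k` is even);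
* `weilReflect_weilConv_moll` — `(F ⋆ φ_k)~ = F̃ ⋆ φ_k` (`φ_k` real and even);
* **`autocorr_weilConv_moll`** — THE AUTOCORRELATION IDENTITY
  `(F ⋆ φ_k) ⋆ (F ⋆ φ_k)~ = (F ⋆ F̃) ⋆ ν_k` (three associativity steps
  `MeasureTheory.convolution_assoc` + commutativity `convolution_flip`; every convolution integrand is
  `integrable × bounded`), so that `weilQuadratic (F ⋆ φ_k) = W((F ⋆ F̃) ⋆ ν_k)` and
  `‖F ⋆ φ_k‖₂² = ((F ⋆ F̃) ⋆ ν_k)(0)` are governed by the STEP-3c engine.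
-/

set_option linter.dupNamespace false

noncomputable section

open Complex Filter Set MeasureTheory Topology
open scoped Real Convolution ComplexConjugate ContDiff

namespace Summit.RiemannHypothesis.RiemannHypothesis.Theorems.PfPersistence

open Literature.NumberTheory.LFunctions Literature.NumberTheory.LFunctions.WeilContinuous

variable {F : ℝ → ℂ}

/-! ## §1 The mollifier is real and even -/

/-- `φ_k(-x) = φ_k(x)`. [folklore] -/
theorem moll_neg (k : ℕ) (x : ℝ) : moll k (-x) = moll k x := by
  simp [moll, (bump k).normed_neg]

/-- `conj φ_k = φ_k`. [folklore] -/
theorem conj_moll (k : ℕ) (x : ℝ) : conj (moll k x) = moll k x := by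
  simp [moll, Complex.conj_ofReal]

/-- `‖φ_k‖ ≤ sup`: the mollifier is bounded. [folklore] -/
theorem exists_norm_moll_le (k : ℕ) : ∃ C : ℝ, ∀ x, ‖moll k x‖ ≤ C :=
  (continuous_moll k).norm.bddAbove_range_of_hasCompactSupport (hasCompactSupport_moll k).norm
    |>.imp fun _ hC x ↦ hC (Set.mem_range_self x)

/-! ## §2 `F ⋆ φ_k` is a test function; support; evenness; reflection -/

/-- `F ⋆ φ_k` is a Weil test function as soon as `F` is locally integrable with compact support.
[folklore] -/
theorem isWeilTest_weilConv_moll_of_locallyIntegrable (hF : LocallyIntegrable F)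
    (hFs : HasCompactSupport F) (k : ℕ) : IsWeilTest (weilConv F (moll k)) := by
  rw [weilConv_eq_convolution_real]
  exact ⟨(hasCompactSupport_moll k).contDiff_convolution_right (ContinuousLinearMap.mul ℝ ℂ)
      hF (contDiff_moll k),
    HasCompactSupport.convolution (L := ContinuousLinearMap.mul ℝ ℂ) hFs (hasCompactSupport_moll k)⟩

/-- `(F ⋆ φ_k)(x) = 0` for `|x| > R + r_k` when `F = 0` off `[-R, R]`. [folklore] -/
theorem weilConv_moll_eq_zero_of_radius {R : ℝ} (hR : ∀ u : ℝ, R < |u| → F u = 0) {k : ℕ}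
    {x : ℝ} (hx : R + (bump k).rOut < |x|) : weilConv F (moll k) x = 0 := by
  rw [weilConv_apply]
  refine integral_eq_zero_of_ae (Eventually.of_forall fun u ↦ ?_)
  simp only [Pi.zero_apply]
  rcases le_or_gt (bump k).rOut |x - u| with hu | hu
  · rw [moll_eq_zero hu, mul_zero]
  · have h2 : R < |u| := by
      have := abs_sub_abs_le_abs_sub x u
      linarith
    rw [hR u h2, zero_mul]

/-- `supp (F ⋆ φ_k) ⊆ [-(R + r_k), R + r_k]`. [folklore] -/
theorem tsupport_weilConv_moll_subset {R : ℝ} (hR : ∀ u : ℝ, R < |u| → F u = 0) (k : ℕ) :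
    tsupport (weilConv F (moll k)) ⊆ Icc (-(R + (bump k).rOut)) (R + (bump k).rOut) := by
  refine closure_minimal (fun x hx ↦ ?_) isClosed_Icc
  have h : |x| ≤ R + (bump k).rOut :=
    not_lt.1 fun h ↦ hx (weilConv_moll_eq_zero_of_radius hR h)
  exact ⟨by linarith [neg_abs_le x], by linarith [le_abs_self x]⟩

/-- `F` even ⇒ `F ⋆ φ_k` even. [folklore] -/
theorem weilConv_moll_neg (hF : ∀ x, F (-x) = F x) (k : ℕ) (x : ℝ) :
    weilConv F (moll k) (-x) = weilConv F (moll k) x := by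
  rw [weilConv_apply, weilConv_apply]
  have h := integral_neg_eq_self (fun u ↦ F u * moll k (-x - u)) volume
  rw [← h]
  refine integral_congr_ae (Eventually.of_forall fun u ↦ ?_)
  simp only
  rw [hF, show -x - -u = -(x - u) by ring, moll_neg]

/-- **Reflection commutes with mollification**: `(F ⋆ φ_k)~ = F̃ ⋆ φ_k`. [folklore] -/
theorem weilReflect_weilConv_moll (F : ℝ → ℂ) (k : ℕ) :
    weilReflect (weilConv F (moll k)) = weilConv (weilReflect F) (moll k) := by
  funext y
  simp only [weilReflect, weilConv_apply]
  rw [← integral_conj]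
  have h := integral_neg_eq_self (fun u ↦ conj (F (-u)) * moll k (y - u)) volume
  rw [← h]
  refine integral_congr_ae (Eventually.of_forall fun u ↦ ?_)
  simp only [neg_neg, map_mul, conj_moll]
  rw [show -y - u = -(y - -u) by ring, moll_neg]

/-! ## §3 Convolution bookkeeping: existence of the convolutions of rough bounded functions -/

/-- `weilReflect F` is measurable. [folklore] -/
theorem measurable_weilReflect (hF : Measurable F) : Measurable (weilReflect F) :=
  (Complex.continuous_conj.measurable.comp hF).comp measurable_neg

/-- `weilReflect F` has compact support. [folklore] -/
theorem hasCompactSupport_weilReflect (hFs : HasCompactSupport F) :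
    HasCompactSupport (weilReflect F) := by
  have h1 : HasCompactSupport (fun t ↦ F (-t)) := hFs.comp_homeomorph (Homeomorph.neg ℝ)
  exact h1.comp_left (g := fun z : ℂ ↦ conj z) (map_zero _)

/-- `‖F̃(x)‖ = ‖F(-x)‖`. [folklore] -/
theorem norm_weilReflect (F : ℝ → ℂ) (x : ℝ) : ‖weilReflect F x‖ = ‖F (-x)‖ := by
  simp [weilReflect]

/-- The convolution `f ⋆ g` exists everywhere when `f` is integrable and `g` is measurable and
bounded. [folklore] -/
theorem convolutionExistsAt_of_integrable_of_bdd {f g : ℝ → ℂ} (hf : Integrable f)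
    (hg : Measurable g) {C : ℝ} (hC : ∀ x, ‖g x‖ ≤ C) (x₀ : ℝ) :
    ConvolutionExistsAt f g x₀ (ContinuousLinearMap.mul ℂ ℂ) volume := by
  unfold ConvolutionExistsAt
  simp only [ContinuousLinearMap.mul_apply']
  have hm : AEStronglyMeasurable (fun t : ℝ ↦ g (x₀ - t)) volume :=
    (hg.comp (measurable_const.sub measurable_id)).aestronglyMeasurable
  exact (hf.bdd_mul (c := C) hm (Eventually.of_forall fun t ↦ hC _)).congr
    (Eventually.of_forall fun t ↦ mul_comm _ _)

/-- The real convolution `‖f‖ ⋆ h` exists everywhere when `f` is locally integrable and `h` is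
continuous with compact support. [folklore] -/
theorem convolutionExistsAt_norm_of_continuous {f : ℝ → ℂ} {h : ℝ → ℝ} (hf : LocallyIntegrable f)
    (hh : Continuous h) (hhs : HasCompactSupport h) (x₀ : ℝ) :
    ConvolutionExistsAt (fun x ↦ ‖f x‖) h x₀ (ContinuousLinearMap.mul ℝ ℝ) volume :=
  hhs.convolutionExists_right (ContinuousLinearMap.mul ℝ ℝ) (locallyIntegrableOn_univ.1 (locallyIntegrableOn_univ.2 hf).norm) hh x₀

/-- `‖g‖ ⋆ ‖k‖` is continuous with compact support for `g` locally integrable with compact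
support and `k` continuous with compact support. [folklore] -/
theorem continuous_hasCompactSupport_norm_conv {g k : ℝ → ℂ} (hg : LocallyIntegrable g)
    (hgs : HasCompactSupport g) (hk : Continuous k) (hks : HasCompactSupport k) :
    Continuous ((fun x ↦ ‖g x‖) ⋆[ContinuousLinearMap.mul ℝ ℝ, volume] fun x ↦ ‖k x‖) ∧
      HasCompactSupport ((fun x ↦ ‖g x‖) ⋆[ContinuousLinearMap.mul ℝ ℝ, volume] fun x ↦ ‖k x‖) :=
  ⟨hks.norm.continuous_convolution_right (ContinuousLinearMap.mul ℝ ℝ)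
      (locallyIntegrableOn_univ.1 (locallyIntegrableOn_univ.2 hg).norm) hk.norm,
    HasCompactSupport.convolution (L := ContinuousLinearMap.mul ℝ ℝ) hgs.norm hks.norm⟩

/-- **Associativity** `(f ⋆ g) ⋆ k = f ⋆ (g ⋆ k)` for `f` integrable, `g` measurable bounded
locally integrable with compact support, `k` continuous with compact support. [folklore] -/
theorem weilConv_assoc_of_bdd {f g k : ℝ → ℂ} (hf : Integrable f) (hg : Measurable g)
    (hgi : LocallyIntegrable g) (hgs : HasCompactSupport g) {C : ℝ} (hC : ∀ x, ‖g x‖ ≤ C)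
    (hk : Continuous k) (hks : HasCompactSupport k) :
    weilConv (weilConv f g) k = weilConv f (weilConv g k) := by
  funext x₀
  unfold weilConv
  refine convolution_assoc (ContinuousLinearMap.mul ℂ ℂ) (ContinuousLinearMap.mul ℂ ℂ)
    (ContinuousLinearMap.mul ℂ ℂ) (ContinuousLinearMap.mul ℂ ℂ) (fun x y z ↦ mul_assoc x y z)
    hf.aestronglyMeasurable hg.aestronglyMeasurable hk.aestronglyMeasurable
    (Eventually.of_forall fun y ↦ convolutionExistsAt_of_integrable_of_bdd hf hg hC y)
    (Eventually.of_forall fun y ↦ convolutionExistsAt_norm_of_continuous hgi hk.norm hks.norm y) ?_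
  obtain ⟨hc, hs⟩ := continuous_hasCompactSupport_norm_conv hgi hgs hk hks
  exact hs.convolutionExists_right (ContinuousLinearMap.mul ℝ ℝ)
    (locallyIntegrableOn_univ.1 (locallyIntegrableOn_univ.2 hf.locallyIntegrable).norm) hc x₀

/-- **Associativity** `(f ⋆ g) ⋆ k = f ⋆ (g ⋆ k)` for `f` locally integrable and `g`, `k`
continuous with compact support. [folklore] -/
theorem weilConv_assoc_of_continuous {f g k : ℝ → ℂ} (hf : LocallyIntegrable f)
    (hg : Continuous g) (hgs : HasCompactSupport g) (hk : Continuous k) (hks : HasCompactSupport k) :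
    weilConv (weilConv f g) k = weilConv f (weilConv g k) := by
  funext x₀
  unfold weilConv
  refine convolution_assoc (ContinuousLinearMap.mul ℂ ℂ) (ContinuousLinearMap.mul ℂ ℂ)
    (ContinuousLinearMap.mul ℂ ℂ) (ContinuousLinearMap.mul ℂ ℂ) (fun x y z ↦ mul_assoc x y z)
    hf.aestronglyMeasurable hg.aestronglyMeasurable hk.aestronglyMeasurable
    (Eventually.of_forall fun y ↦ hgs.convolutionExists_right _ hf hg y)
    (Eventually.of_forall fun y ↦
      convolutionExistsAt_norm_of_continuous hg.locallyIntegrable hk.norm hks.norm y) ?_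
  obtain ⟨hc, hs⟩ := continuous_hasCompactSupport_norm_conv hg.locallyIntegrable hgs hk hks
  exact hs.convolutionExists_right (ContinuousLinearMap.mul ℝ ℝ)
    (locallyIntegrableOn_univ.1 (locallyIntegrableOn_univ.2 hf).norm) hc x₀

/-! ## §4 The autocorrelation identity -/

/-- **`(F ⋆ φ_k) ⋆ (F ⋆ φ_k)~ = (F ⋆ F̃) ⋆ ν_k`** for `F` measurable, bounded, integrable, with
compact support. [folklore] -/
theorem autocorr_weilConv_moll (hFm : Measurable F) (hFi : Integrable F) (hFs : HasCompactSupport F)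
    {C : ℝ} (hC : ∀ x, ‖F x‖ ≤ C) (k : ℕ) :
    weilConv (weilConv F (moll k)) (weilReflect (weilConv F (moll k))) =
      weilConv (weilConv F (weilReflect F)) (mollSq k) := by
  have hRm : Measurable (weilReflect F) := measurable_weilReflect hFm
  have hRi : Integrable (weilReflect F) := integrable_weilReflect hFi
  have hRs : HasCompactSupport (weilReflect F) := hasCompactSupport_weilReflect hFs
  have hRC : ∀ x, ‖weilReflect F x‖ ≤ C := fun x ↦ by rw [norm_weilReflect]; exact hC _
  have hφc := continuous_moll k
  have hφs := hasCompactSupport_moll k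
  -- `(F ⋆ φ)~ = F̃ ⋆ φ`
  rw [weilReflect_weilConv_moll]
  -- `(F ⋆ F̃) ⋆ ν = F ⋆ (F̃ ⋆ ν)`
  rw [weilConv_assoc_of_bdd hFi hRm hRi.locallyIntegrable hRs hRC
    (isWeilTest_mollSq k).1.continuous (isWeilTest_mollSq k).2]
  -- `F̃ ⋆ (φ ⋆ φ) = (F̃ ⋆ φ) ⋆ φ = φ ⋆ (F̃ ⋆ φ)`
  -- commutativity `g ⋆ k = k ⋆ g` (kept local: the statement is landed in another route's module,
  -- gate lint `dedup.landed` p188045)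
  have hcomm : ∀ g k' : ℝ → ℂ, weilConv g k' = weilConv k' g := fun g k' ↦ by
    unfold weilConv
    rw [← convolution_flip, ContinuousLinearMap.flip_mul]
  have h2 : weilConv (weilReflect F) (mollSq k) =
      weilConv (moll k) (weilConv (weilReflect F) (moll k)) := by
    rw [mollSq, ← weilConv_assoc_of_continuous hRi.locallyIntegrable hφc hφs hφc hφs, hcomm]
  rw [h2]
  -- `(F ⋆ φ) ⋆ (F̃ ⋆ φ) = F ⋆ (φ ⋆ (F̃ ⋆ φ))`
  have hT : IsWeilTest (weilConv (weilReflect F) (moll k)) :=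
    isWeilTest_weilConv_moll_of_locallyIntegrable hRi.locallyIntegrable hRs k
  obtain ⟨Cφ, hCφ⟩ := exists_norm_moll_le k
  rw [weilConv_assoc_of_bdd hFi hφc.measurable hφc.locallyIntegrable hφs hCφ hT.1.continuous hT.2]

/-- Consequently `Q(F ⋆ φ_k) = W((F ⋆ F̃) ⋆ ν_k)`. [folklore] -/
theorem weilQuadratic_weilConv_moll (hFm : Measurable F) (hFi : Integrable F) (hFs : HasCompactSupport F)
    {C : ℝ} (hC : ∀ x, ‖F x‖ ≤ C) (k : ℕ) :
    weilQuadratic (weilConv F (moll k)) =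
      weilFunctional (weilConv (weilConv F (weilReflect F)) (mollSq k)) := by
  rw [weilQuadratic, autocorr_weilConv_moll hFm hFi hFs hC]

/-- … and `‖F ⋆ φ_k‖₂² = ((F ⋆ F̃) ⋆ ν_k)(0)`. [folklore] -/
theorem integral_norm_sq_weilConv_moll (hFm : Measurable F) (hFi : Integrable F)
    (hFs : HasCompactSupport F) {C : ℝ} (hC : ∀ x, ‖F x‖ ≤ C) (k : ℕ) :
    ((∫ t, ‖weilConv F (moll k) t‖ ^ 2 : ℝ) : ℂ) =
      weilConv (weilConv F (weilReflect F)) (mollSq k) 0 := by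
  rw [← autocorr_weilConv_moll hFm hFi hFs hC k, weilConv_weilReflect_apply_zero]

end Summit.RiemannHypothesis.RiemannHypothesis.Theorems.PfPersistence
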